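import Literature.NumberTheory.EllipticCurves.Rank1Residual.Typed.X6
import Literature.NumberTheory.EllipticCurves.Rank1Residual.Typed.X7
import Literature.NumberTheory.EllipticCurves.Rank1Residual.Typed.X8
import Literature.NumberTheory.EllipticCurves.Rank1Residual.Typed.SelmerCardCertificateRankZero
import HarnessLib

/-!
# Supersingular `p = 3`, analytic rank `0`, `#Ш_an = 9`: the typed LOWER half from the native
# `3`-descent certificate line `Sel^(3)(E/ℚ) ≠ 0` — classes X6 / X7 / X8 (cell `b2b-bsdres`,
# supersingular family, prover A = unit `b2b-bsdres-x10b`, gen 5)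

HONEST FRAMING (run/shared/lean/b2b/bsd-rank1-residual/, verbatim in every file): the goal of the
cell is to DELETE the COMBINATION-SHAPED residual classes of the Birch–Swinnerton-Dyer formula for
ALL analytic-rank `≤ 1` elliptic curves over `ℚ` — "full BSD formula for every rank `≤ 1` curve in
class `C`" assembled STRICTLY from published theorems — so that the rank-`≤ 1` remainder becomes
exactly the CONSTRUCTION-SHAPED classes, which are TYPED (missing-input `Prop`s), NOT attempted.
This is not "finishing BSD". Classes X6/X7/X8 stay CONSTRUCTION-SHAPED; nothing is booked here; the
theorems below are PER-PAIR certificate consumers: every input is a PUBLISHED theorem taken by name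
(Wuthrich 2014 Prop. 21 `hW`, Cassels 1962 / Silverman X.4.14 `hCT`, Gross–Zagier–Kolyvagin `hGZK`,
modularity `hmod`) plus ONE finite certificate line per curve, `Sel^(3)(E/ℚ) ≠ 0`, which the cell's
two independent exact `3`-descent implementations produce (engine 1 = x11b `desc3lib.gp` EXACT-3,
engine 2 = this unit's `desc3full_e2.py`, `HOME/b2b-bsdres-x10b/X678-DESC3.md`).

Theorems only (no definition, no named fact). What is new relative to
`Typed/SelmerCardCertificateRankZero.lean` (x11b: the class-free consumer
`bsdp_of_wuthrich_of_casselsTate_of_selmerGroup_ne_bot` and its X11 instance): the typed LOWER half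
`MissingLowerBoundAt W p` is isolated as a consequence of the certificate alone (no Wuthrich, no image
hypothesis: `missingLowerBoundAt_of_casselsTate_of_selmerGroup_ne_bot`), and the X6 / X7 / X8
instances discharge their side conditions from the class predicates: not additive at `p` (good
reduction), `p ∤ #E(ℚ)_tors` (`E[p]` irreducible at a good supersingular odd `p`, Serre 1972 §1.11
Prop. 12, via `ClassX6.irr` / `ClassX7.irr` / `ClassX8.irr`, and Mazur), the image proviso of
Wuthrich's bound (`ClassX6.surj` automatic; a `Surj W p` binder for X7 and non-semistable X8,
`ClassX8.surj_of_semistable`). Census use (N < 2·10⁴, p = 3, r_an = 0, `#Ш_an = 9`): X6 ×12,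
X7 ×23, X8 ×49 pairs of the sha-2 census tier `T-full3`.

References: [Wuthrich2014] Prop. 21; [SilvermanAEC2009] Thm. X.4.14, X.4.2; [Serre1972] §1.11
Prop. 12, §5.4 Prop. 21; [Mazur1977]; [Miller2011LMS] Def. 1.1; Schaefer–Stoll, Trans. AMS 356 (2004).
-/

noncomputable section

open scoped Classical

open WeierstrassCurve Literature.NumberTheory.EllipticCurves
  Literature.NumberTheory.EllipticCurves.Rank1Residual
  Literature.NumberTheory.EllipticCurves.Rank1Residual.Typed
  Literature.NumberTheory.EllipticCurves.Wuthrich2014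

namespace Summit.BirchSwinnertonDyer.Rank1Residual.Supersingular

variable (W : WeierstrassCurve ℚ) [W.IsElliptic] (p : ℕ) [Fact p.Prime]

/-- `E[p]` irreducible ⇒ `p ∤ #E(ℚ)_tors` (a rational point of order `p` spans a Galois-stable line;
tree theorem `padicValNat_torsionOrder_eq_zero_of_irreducible`). [cite: SilvermanAEC2009, Thm X.4.2(a)] -/
theorem not_dvd_torsionOrder_of_irr (hirr : Irr W p) : ¬ p ∣ W.torsionOrder := by
  intro hdvd
  have h0 := padicValNat_torsionOrder_eq_zero_of_irreducible W p hirr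
  rw [padicValNat.eq_zero_iff] at h0
  rcases h0 with h | h | h
  · exact (Fact.out : p.Prime).one_lt.ne' h
  · exact W.torsionOrder_pos_holds.ne' h
  · exact h hdvd

/-- **The typed LOWER half from the native certificate, class-free.** At a pair with
`ord_{s=1} L(E,s) = 0`, `#Ш(E/ℚ)_an = q` with `ord_p q ≤ 2`, `p ∤ #E(ℚ)_tors` and
`Sel^(p)(E/ℚ) ≠ 0`: `MissingLowerBoundAt W p` (`ord_p #Ш_an ≤ ord_p #Ш`). Chain: rank `0` and
`Ш` finite by Gross–Zagier–Kolyvagin (`hGZK`); no `p`-torsion + rank `0` ⇒ `Sel^(p) ≅ Ш[p]`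
(`exists_sha_torsion_of_selmerGroup_ne_bot`, PROVED fundamental sequence) ⇒ `p ∣ #Ш`
(`dvd_shaOrder_of_exists_torsion`) ⇒ `p² ∣ #Ш` by Cassels–Tate squareness (`hCT`,
`missingLowerBoundAt_of_casselsTate_of_pow_dvd`). No upper-bound input, no image hypothesis.
[cite: SilvermanAEC2009, Thm. X.4.14] [cite: Miller2011LMS, Def. 1.1] -/
theorem missingLowerBoundAt_of_casselsTate_of_selmerGroup_ne_bot
    (hCT : exists_casselsTate_pairing (K := ℚ))
    (hGZK : rank_eq_analyticRank_of_analyticRank_le_one) (hr : W.analyticRank = 0)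
    (htors : ¬ p ∣ W.torsionOrder) {q : ℚ} (hq : shaAn W = (q : ℂ)) (hv : padicValRat p q ≤ 2)
    (hSel : W.selmerGroup (p : ℤ) ≠ ⊥) : MissingLowerBoundAt W p := by
  have hrank : W.mordellWeilRank = 0 := by
    rw [(hGZK W (by rw [hr]; norm_num)).1, hr]
  have hex : ∃ x : W.sha, x ≠ 0 ∧ p • x = 0 :=
    exists_sha_torsion_of_selmerGroup_ne_bot W p hSel hrank htors
  exact missingLowerBoundAt_of_casselsTate_of_pow_dvd W p hCT (hGZK W (by rw [hr]; norm_num)).2 hq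
    (k := 1) (by simpa using hv) (by simpa using dvd_shaOrder_of_exists_torsion W p hex)

variable [W.IsGloballyMinimal]

/-- **X6 ∩ {r_an = 0}, odd `p`, `ord_p #Ш_an ≤ 2`: `BSD(E,p)` from PUBLISHED theorems + the native
certificate line `Sel^(p)(E/ℚ) ≠ 0`.** Inputs by name: Cassels–Tate (`hCT`), Wuthrich 2014 Prop. 21
(`hW`; not additive since good at `p`; image proviso by `ClassX6.surj`), GZK (`hGZK`), modularity
(`hmod`); `p ∤ #E(ℚ)_tors` from `ClassX6.irr`. Census instances (`p = 3`, `a_3 = 0`, `#Ш_an = 9`,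
N < 2·10⁴): 2534e1, 4343b1, 4963c1, 5561a1, 8710b1, 12034a1, 15755a1, 16982a1, 17917b1, 19142a1,
19822e1, 19918b1 — each with `dim_𝔽₃ Sel^(3)(E/ℚ) = 2` on two independent engines. Per-pair; NOT a
class theorem. [cite: Wuthrich2014, Prop. 21 (p. 400)] [cite: SilvermanAEC2009, Thm. X.4.14]
[cite: Serre1972, §1.11 Prop. 12 and §5.4 Prop. 21 i)] [cite: Miller2011LMS, §1 and Def. 1.1] -/
theorem X6.bsdp_rankZero_of_casselsTate_of_selmerGroup_ne_bot
    (hCT : exists_casselsTate_pairing (K := ℚ)) (hW : sha_dvd_analyticSha)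
    (hGZK : rank_eq_analyticRank_of_analyticRank_le_one) (hmod : hasEntireLFunction_rat)
    (hp : p ≠ 2) (hX : ClassX6 W p) (hr : W.analyticRank = 0)
    {q : ℚ} (hq : shaAn W = (q : ℂ)) (hv : padicValRat p q ≤ 2)
    (hSel : W.selmerGroup (p : ℤ) ≠ ⊥) : BSDp W p :=
  X6.bsdp_of_missingLowerBoundAt_of_analyticRank_eq_zero W p hW hGZK hmod hp hX hr
    (missingLowerBoundAt_of_casselsTate_of_selmerGroup_ne_bot W p hCT hGZK hr
      (not_dvd_torsionOrder_of_irr W p (ClassX6.irr W p hp hX)) hq hv hSel)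

/-- **X7 ∩ {r_an = 0}, odd `p`, SURJECTIVE `ρ̄_{E,p}` (per-pair datum), `ord_p #Ш_an ≤ 2`:
`BSD(E,p)` from PUBLISHED theorems + the native certificate line `Sel^(p)(E/ℚ) ≠ 0`.** As for X6
with the image proviso of Wuthrich's Prop. 21 supplied per pair (`hs`; X7 curves are not semistable,
so surjectivity is not automatic); `p ∤ #E(ℚ)_tors` from `ClassX7.irr`. Census instances (`p = 3`,
`#Ш_an = 9`, N < 2·10⁴): the 23 rank-`0` X7 pairs of the sha-2 tier `T-full3`. Per-pair; NOT a class
theorem. [cite: Wuthrich2014, Prop. 21 (p. 400)] [cite: SilvermanAEC2009, Thm. X.4.14]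
[cite: Serre1972, §1.11 Prop. 12] [cite: Miller2011LMS, §1 and Def. 1.1] -/
theorem X7.bsdp_rankZero_of_casselsTate_of_selmerGroup_ne_bot_of_surj
    (hCT : exists_casselsTate_pairing (K := ℚ)) (hW : sha_dvd_analyticSha)
    (hGZK : rank_eq_analyticRank_of_analyticRank_le_one) (hmod : hasEntireLFunction_rat)
    (hp : p ≠ 2) (hX : ClassX7 W p) (hs : Surj W p) (hr : W.analyticRank = 0)
    {q : ℚ} (hq : shaAn W = (q : ℂ)) (hv : padicValRat p q ≤ 2)
    (hSel : W.selmerGroup (p : ℤ) ≠ ⊥) : BSDp W p :=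
  X7.bsdp_of_missingLowerBoundAt_of_surj W p hW hGZK hmod hp hX hs hr
    (missingLowerBoundAt_of_casselsTate_of_selmerGroup_ne_bot W p hCT hGZK hr
      (not_dvd_torsionOrder_of_irr W p (ClassX7.irr W p hp hX)) hq hv hSel)

/-- **X8 ∩ {r_an = 0}, SURJECTIVE `ρ̄_{E,3}` (per-pair datum), `ord_3 #Ш_an ≤ 2`: `BSD(E,p)` from
PUBLISHED theorems + the native certificate line `Sel^(p)(E/ℚ) ≠ 0`** (`p = 3` on X8;
`p ∤ #E(ℚ)_tors` from `ClassX8.irr'`). Census instances (`#Ш_an = 9`, N < 2·10⁴): the 49 rank-`0`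
X8 pairs of the sha-2 tier `T-full3`. Per-pair; NOT a class theorem.
[cite: Wuthrich2014, Prop. 21 (p. 400)] [cite: SilvermanAEC2009, Thm. X.4.14]
[cite: Serre1972, §1.11 Prop. 12] [cite: Miller2011LMS, §1 and Def. 1.1] -/
theorem X8.bsdp_rankZero_of_casselsTate_of_selmerGroup_ne_bot_of_surj
    (hCT : exists_casselsTate_pairing (K := ℚ)) (hW : sha_dvd_analyticSha)
    (hGZK : rank_eq_analyticRank_of_analyticRank_le_one) (hmod : hasEntireLFunction_rat)
    (hX : ClassX8 W p) (hs : Surj W p) (hr : W.analyticRank = 0)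
    {q : ℚ} (hq : shaAn W = (q : ℂ)) (hv : padicValRat p q ≤ 2)
    (hSel : W.selmerGroup (p : ℤ) ≠ ⊥) : BSDp W p :=
  X8.bsdp_of_missingLowerBoundAt_of_surj W p hW hGZK hmod hX hs hr
    (missingLowerBoundAt_of_casselsTate_of_selmerGroup_ne_bot W p hCT hGZK hr
      (not_dvd_torsionOrder_of_irr W p (ClassX8.irr' W p hX)) hq hv hSel)

/-- **X8 ∩ {sst} ∩ {r_an = 0}, `ord_3 #Ш_an ≤ 2`: `BSD(E,p)` from PUBLISHED theorems + the native
certificate line `Sel^(p)(E/ℚ) ≠ 0`, with NO image binder** (`ClassX8.surj_of_semistable`: good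
supersingular `3` on a semistable curve forces surjectivity, Serre §5.4 Prop. 21 i)).
[cite: Wuthrich2014, Prop. 21 (p. 400)] [cite: SilvermanAEC2009, Thm. X.4.14]
[cite: Serre1972, §1.11 Prop. 12 and §5.4 Prop. 21 i)] [cite: Miller2011LMS, §1 and Def. 1.1] -/
theorem X8.bsdp_rankZero_of_casselsTate_of_selmerGroup_ne_bot_of_semistable
    (hCT : exists_casselsTate_pairing (K := ℚ)) (hW : sha_dvd_analyticSha)
    (hGZK : rank_eq_analyticRank_of_analyticRank_le_one) (hmod : hasEntireLFunction_rat)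
    (hX : ClassX8 W p) (hsst : Semistable W) (hr : W.analyticRank = 0)
    {q : ℚ} (hq : shaAn W = (q : ℂ)) (hv : padicValRat p q ≤ 2)
    (hSel : W.selmerGroup (p : ℤ) ≠ ⊥) : BSDp W p :=
  X8.bsdp_of_missingLowerBoundAt_of_semistable W p hW hGZK hmod hX hsst hr
    (missingLowerBoundAt_of_casselsTate_of_selmerGroup_ne_bot W p hCT hGZK hr
      (not_dvd_torsionOrder_of_irr W p (ClassX8.irr' W p hX)) hq hv hSel)

end Summit.BirchSwinnertonDyer.Rank1Residual.Supersingular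

end
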